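import Literature.Probability.Percolation.IsoradialPathCrossing
import Literature.Probability.Percolation.IsoradialDualMeasure
import Literature.Probability.LatticeModels.IsoradialReflection
import Literature.Probability.Percolation.CornerPercolation
import HarnessLib

/-!
# Primal horizontal crossings versus dual vertical crossings of an isoradial rhombic tiling

Planar duality for crossing events (Grimmett–Manolescu, PTRF 159 (2014) = arXiv:1204.0505,
§2.2: "the canonical measure `P_{G*}` is dual to the primal measure `P_G`", used at the end of §3
for the box-crossing property of both `G` and `G*`; Grimmett, *Percolation* (1999), §11.2): an
open horizontal crossing of a box by `G` and a dual-open vertical crossing of the box by `G*`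
cannot coexist, so that `P_G(horizontal crossing) ≤ 1 - P_G(ω* crosses vertically)`, the upper
half of the two-sided box-crossing bounds `BoxCrossingBounds` once lower bounds for `G*` are
known. For an isoradial rhombic tiling (`IsIsoradial`, `IsRhombicTiling`):

* `toCurve_inter_nonempty_of_crossing₂` — the topological step (Maehara's crossing lemma) for
  two walks on *different* vertex types with their own drawings (here `V` drawn by `z` and `F`
  drawn by `c`);
* `range_toCurve_inter_eq_empty_of_dual` — **an open path and a dual-open path do not meet**:
  their polygonal curves are disjoint, *provided no vertex position coincides with a face-centre
  position* (`hclash`). A common point would lie on an open primal edge and a dual-open dual edge;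
  if these are the diagonals of one rhombus the edge would be both open and closed, otherwise
  they can only meet at a common corner position (`segment_z_inter_segment_c_subset`), excluded by
  `hclash`;
* `not_mem_embTBCrossing_dualConfig` — hence `ω ∈` (horizontal crossing of `w + [0, a] × [0, b]`)
  excludes `ω* ∈` (vertical crossing, by the dual drawing, of an inner vertical strip);
* `real_embRectCrossing_add_real_dualConfig_preimage_le_one` — the probability inequality under
  `P_G` (no countability of `F` needed), and `real_embRectCrossing_le_one_sub_dual` — the same
  with the dual probability read under `P_{G*}` (`isoradialPercolation_real_dualConfig_preimage`)
  when `F` is countable.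

**On the hypothesis `hclash`** (`∀ d D : G.Dart, z d.fst ≠ c (leftFace D)`): it is NOT a
consequence of `IsIsoradial ∧ IsRhombicTiling` (relabel the rhombi of a half-plane of a genuine
tiling by exchanging primal and dual corners: both predicates survive, `G` becomes disconnected,
and positions clash along the boundary line); it does follow from these together with
`G.Preconnected` by a global parity argument (the diamond graph is a bipartite quadrangulation —
Grimmett–Manolescu 2014, §4.1, "`G^◇` is bipartite"; Kenyon–Schlenker 2005), which is not
formalized here. Every genuine rhombic tiling in the sense of the paper satisfies it.

## References

* G. R. Grimmett, I. Manolescu, *Bond percolation on isoradial graphs: criticality and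
  universality*, PTRF 159 (2014), arXiv:1204.0505, §2.2 (duality), end of §3, §4.1.
* G. Grimmett, *Percolation*, 2nd ed. (1999), §11.2 (planar duality).
* R. Maehara, *The Jordan curve theorem via the Brouwer fixed point theorem*, Amer. Math. Monthly
  91 (1984) (crossing lemma).
-/

noncomputable section

namespace Literature.Probability.Percolation

open MeasureTheory Complex Set
open Literature.Probability.LatticeModels Literature.Probability.LatticeModels.RhombicEmbedding
  Literature.Topology.PlaneTopology

/-! ### The topological step for two vertex types -/

/-- **Crossing curves meet** (two vertex types). Let `p` be a walk on `V₁`, drawn by `f₁`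
inside the horizontal strip `{c₁ ≤ im ≤ c₂}` from `{re ≤ a₁}` to `{a₂ ≤ re}`, and `q` a walk on
`V₂`, drawn by `f₂` inside the vertical strip `{a₁ ≤ re ≤ a₂}` from `{im ≤ c₁}` to `{c₂ ≤ im}`,
`a₁ ≤ a₂`, `c₁ ≤ c₂`. Then the two polygonal curves have a common point (Maehara's crossing
lemma, as in `toCurve_inter_nonempty_of_crossing`). [cite: Maehara1984, Lemma] -/
theorem toCurve_inter_nonempty_of_crossing₂ {V₁ V₂ : Type*} (f₁ : V₁ → ℂ) (f₂ : V₂ → ℂ)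
    {H₁ : SimpleGraph V₁} {H₂ : SimpleGraph V₂} {x y : V₁} {x' y' : V₂} (p : H₁.Walk x y)
    (q : H₂.Walk x' y') {a₁ a₂ c₁ c₂ : ℝ} (ha : a₁ ≤ a₂) (hc : c₁ ≤ c₂)
    (hp : ∀ v ∈ p.support, (f₁ v).im ∈ Icc c₁ c₂) (hx : (f₁ x).re ≤ a₁) (hy : a₂ ≤ (f₁ y).re)
    (hq : ∀ v ∈ q.support, (f₂ v).re ∈ Icc a₁ a₂) (hx' : (f₂ x').im ≤ c₁)
    (hy' : c₂ ≤ (f₂ y').im) :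
    (Set.range (p.toCurve f₁) ∩ Set.range (q.toCurve f₂)).Nonempty := by
  set P : ℝ → ℂ := fun s => p.toCurve f₁ (Set.projIcc 0 1 zero_le_one s) with hP
  set Q : ℝ → ℂ := fun s => q.toCurve f₂ (Set.projIcc 0 1 zero_le_one s) with hQ
  have hPc : Continuous P := (p.toCurve f₁).continuous.comp continuous_projIcc
  have hQc : Continuous Q := (q.toCurve f₂).continuous.comp continuous_projIcc
  have hP0 : P 0 = f₁ x := by simp [hP, Set.projIcc_left]
  have hP1 : P 1 = f₁ y := by
    simp only [hP, Set.projIcc_right]; exact toCurve_one f₁ p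
  have hQ0 : Q 0 = f₂ x' := by simp [hQ, Set.projIcc_left]
  have hQ1 : Q 1 = f₂ y' := by
    simp only [hQ, Set.projIcc_right]; exact toCurve_one f₂ q
  have hPstrip : ∀ s, (P s).im ∈ Icc c₁ c₂ := by
    intro s
    have hconv : Convex ℝ {w : ℂ | w.im ∈ Icc c₁ c₂} := (convex_Icc c₁ c₂).linear_preimage imLm
    exact range_toCurve_subset_of_convex f₁ p hconv hp ⟨_, rfl⟩
  have hQstrip : ∀ s, (Q s).re ∈ Icc a₁ a₂ := by
    intro s
    have hconv : Convex ℝ {w : ℂ | w.re ∈ Icc a₁ a₂} := (convex_Icc a₁ a₂).linear_preimage reLm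
    exact range_toCurve_subset_of_convex f₂ q hconv hq ⟨_, rfl⟩
  obtain ⟨s₀, s₁, hs₀, hs₀₁, hs₁, hgs₀, hgs₁, hPclip⟩ :=
    exists_clip_Icc (g := fun s => (P s).re) (continuous_re.comp hPc).continuousOn ha
      (by simpa [hP0] using hx) (by simpa [hP1] using hy)
  obtain ⟨t₀, t₁, ht₀, ht₀₁, ht₁, hgt₀, hgt₁, hQclip⟩ :=
    exists_clip_Icc (g := fun s => (Q s).im) (continuous_im.comp hQc).continuousOn hc
      (by simpa [hQ0] using hx') (by simpa [hQ1] using hy')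
  set γ : ℝ → ℂ := fun u => P (s₀ + u * (s₁ - s₀)) with hγ
  set β : ℝ → ℂ := fun u => Q (t₀ + u * (t₁ - t₀)) with hβ
  have hγc : Continuous γ := hPc.comp (continuous_const.add (continuous_id.mul continuous_const))
  have hβc : Continuous β := hQc.comp (continuous_const.add (continuous_id.mul continuous_const))
  have hmemI : ∀ {u lo hi : ℝ}, lo ≤ hi → u ∈ Icc (0 : ℝ) 1 → lo + u * (hi - lo) ∈ Icc lo hi := by
    intro u lo hi hlh hu
    obtain ⟨hu0, hu1⟩ := hu
    constructor <;> nlinarith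
  have hγK : MapsTo γ (Icc 0 1) (Icc a₁ a₂ ×ℂ Icc c₁ c₂) := by
    intro u hu
    rw [mem_reProdIm]
    exact ⟨hPclip _ (hmemI hs₀₁ hu), hPstrip _⟩
  have hβK : MapsTo β (Icc 0 1) (Icc a₁ a₂ ×ℂ Icc c₁ c₂) := by
    intro u hu
    rw [mem_reProdIm]
    exact ⟨hQstrip _, hQclip _ (hmemI ht₀₁ hu)⟩
  have hγ0 : (γ 0).re = a₁ := by simp [hγ, hgs₀]
  have hγ1 : (γ 1).re = a₂ := by simp [hγ, hgs₁]
  have hβ0 : (β 0).im = c₁ := by simp [hβ, hgt₀]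
  have hβ1 : (β 1).im = c₂ := by simp [hβ, hgt₁]
  obtain ⟨s, -, t, -, hst⟩ :=
    exists_mem_of_crossing hβc.continuousOn hγc.continuousOn hβK hγK hβ0 hβ1 hγ0 hγ1
  refine ⟨β t, ?_, ?_⟩
  · rw [hst]; exact ⟨_, rfl⟩
  · exact ⟨_, rfl⟩

/-! ### An open path and a dual-open path do not meet -/

section Tiling

variable {V F : Type*} {G : SimpleGraph V} {emb : RhombicEmbedding G F}

/-- **Open and dual-open paths are disjoint** (under the no-clash hypothesis `hclash`, see the
module docstring). For a configuration `ω ⊆ E(G)`, the polygonal curve of a non-trivial walk in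
the open graph (vertices at `z`) and that of a non-trivial walk in the dual open graph (faces at
`c`) have no common point. (Grimmett 1999, §11.2; Grimmett–Manolescu 2014, §4.1: `e` and `e*`
are the diagonals of one rhombus, and `e*` is open iff `e` is closed.)
[cite: GrimmettManolescu2014Isoradial, §2.2 (ω*(e*) = 1 − ω(e)) and §4.1] -/
theorem range_toCurve_inter_eq_empty_of_dual (hiso : emb.IsIsoradial) (hrh : emb.IsRhombicTiling)
    (hclash : ∀ d D : G.Dart, emb.z d.fst ≠ emb.c (emb.leftFace D)) {ω : BondConfig V}
    (hω : ω ⊆ G.edgeSet) {H₂ : SimpleGraph F} (h₂ : H₂ ≤ emb.dualOpenGraph ω) {x y : V} {f g : F}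
    {p : (openGraph ω).Walk x y} {q : H₂.Walk f g} (hp : ¬ p.Nil) (hq : ¬ q.Nil) :
    Set.range (p.toCurve emb.z) ∩ Set.range (q.toCurve emb.c) = ∅ := by
  rw [Set.eq_empty_iff_forall_notMem]
  rintro X ⟨hXp, hXq⟩
  obtain ⟨d, hd, hX₁⟩ := Set.mem_iUnion₂.1 (range_toCurve_subset_iUnion emb.z hp hXp)
  obtain ⟨D, hD, hX₂⟩ := Set.mem_iUnion₂.1 (range_toCurve_subset_iUnion emb.c hq hXq)
  -- the primal dart `d` is open and a dart of `G`
  have hdω : s(d.fst, d.snd) ∈ ω := ((openGraph_adj ω _ _).1 d.adj).1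
  set d' : G.Dart := ⟨d.toProd, openGraph_le_of_subset hω d.adj⟩ with hd'
  -- the dual dart `D` crosses a closed primal dart `e`
  have hDadj : (emb.dualOpenGraph ω).Adj D.fst D.snd := h₂ D.adj
  set D' : emb.dualGraph.Dart := ⟨D.toProd, emb.dualOpenGraph_le_dualGraph ω hDadj⟩ with hD'
  set e : G.Dart := emb.primalDart D' with he
  have heω : e.edge ∉ ω := (dualOpenGraph_adj_iff hiso hrh D').1 hDadj
  have hlf : emb.leftFace e = D.fst := emb.leftFace_primalDart hiso D'
  have hrf : emb.rightFace e = D.snd := emb.rightFace_primalDart hiso D'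
  have hX₂' : X ∈ segment ℝ (emb.c (emb.leftFace e)) (emb.c (emb.rightFace e)) := by
    rw [hlf, hrf]; exact hX₂
  by_cases hde : d'.edge = e.edge
  · -- same rhombus: `e` would be open and closed
    apply heω
    rw [← hde]
    exact hdω
  · have hmem := segment_z_inter_segment_c_subset hiso hrh hde ⟨hX₁, hX₂'⟩
    simp only [mem_inter_iff, mem_insert_iff, mem_singleton_iff] at hmem
    obtain ⟨hA, hB⟩ := hmem
    have hrf' : emb.c (emb.rightFace e) = emb.c (emb.leftFace e.symm) := by
      rw [hiso.leftFace_symm]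
    rcases hA with hA | hA <;> rcases hB with hB | hB
    · exact hclash d' e (hA.symm.trans hB)
    · exact hclash d' e.symm (hA.symm.trans (hB.trans hrf'))
    · exact hclash d'.symm e (hA.symm.trans hB)
    · exact hclash d'.symm e.symm (hA.symm.trans (hB.trans hrf'))

/-- Walk formulation of the vertical crossing event (the reflected form of
`mem_embRectCrossing_iff`). [folklore] -/
theorem mem_embTBCrossing_iff {W : Type*} {zW : W → ℂ} {a b : ℝ} {ω : BondConfig W} :
    ω ∈ embTBCrossing zW a b ↔ ∃ (x y : W) (p : (openGraph ω).Walk x y),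
      (zW x).im ≤ 0 ∧ b ≤ (zW y).im ∧
      ∀ v ∈ p.support, (zW v).re ∈ Icc 0 a ∧ (zW v).im ∈ Icc (-2) (b + 2) := by
  have h := embTBCrossing_eq_embRectCrossing_reflect zW 0 a b
  simp only [sub_zero] at h
  have h0 : swapXY 0 = 0 := rfl
  rw [h0] at h
  simp only [sub_zero] at h
  rw [h, mem_embRectCrossing_iff_holds]
  simp only [swapXY_re, swapXY_im]
  constructor <;> rintro ⟨x, y, p, h1, h2, h3⟩ <;> exact ⟨x, y, p, h1, h2, fun v hv => (h3 v hv).symm⟩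

/-- **A horizontal open crossing excludes a vertical dual-open crossing of an inner strip**
(under `hclash`). If `ω ⊆ E(G)` crosses `w + [0, a] × [0, b]` horizontally (rendered event, by
the drawing `z`), then its dual configuration `ω*` does not cross vertically — by the dual drawing
`c` — the box `w' + [0, a'] × [0, b']`, whenever that box's horizontal extent lies within
`[w.re, w.re + a]`, `a' > 0`, `b > 0`, and its vertical extent contains `[w.im, w.im + b]`.
(Grimmett 1999, §11.2; Grimmett–Manolescu 2014, end of §3.) [cite: GrimmettManolescu2014Isoradial, §2.2 and end of §3 (duality for box crossings)] -/
theorem not_mem_embTBCrossing_dualConfig (hiso : emb.IsIsoradial) (hrh : emb.IsRhombicTiling)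
    (hclash : ∀ d D : G.Dart, emb.z d.fst ≠ emb.c (emb.leftFace D)) {ω : BondConfig V}
    (hω : ω ⊆ G.edgeSet) {w w' : ℂ} {a b a' b' : ℝ} (ha' : 0 < a') (hb : 0 < b)
    (h1 : w.re ≤ w'.re) (h2 : w'.re + a' ≤ w.re + a) (h3 : w'.im ≤ w.im)
    (h4 : w.im + b ≤ w'.im + b') (hLR : ω ∈ embRectCrossing (fun v => emb.z v - w) a b) :
    emb.dualConfig ω ∉ embTBCrossing (fun f => emb.c f - w') a' b' := by
  intro hTB
  rw [mem_embRectCrossing_iff_holds] at hLR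
  obtain ⟨x, y, p, hx, hy, hp⟩ := hLR
  rw [mem_embTBCrossing_iff] at hTB
  obtain ⟨f, g, q, hf, hg, hq⟩ := hTB
  have h₂ : openGraph (emb.dualConfig ω) ≤ emb.dualOpenGraph ω := le_of_eq (emb.openGraph_dualConfig ω)
  -- both walks are non-trivial
  have hpN : ¬ p.Nil := by
    rintro ⟨⟩
    simp only [Complex.sub_re] at hx hy
    linarith
  have hqN : ¬ q.Nil := by
    rintro ⟨⟩
    simp only [Complex.sub_im] at hf hg
    linarith
  have hne := toCurve_inter_nonempty_of_crossing₂ emb.z emb.c p q (a₁ := w'.re) (a₂ := w'.re + a')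
    (c₁ := w.im) (c₂ := w.im + b) (by linarith) (by linarith)
    (fun v hv => by
      obtain ⟨-, h5, h6⟩ := hp v hv
      simp only [Complex.sub_im] at h5 h6
      exact ⟨by linarith, by linarith⟩)
    (by simp only [Complex.sub_re] at hx; linarith)
    (by simp only [Complex.sub_re] at hy; linarith)
    (fun v hv => by
      obtain ⟨⟨h5, h6⟩, -⟩ := hq v hv
      simp only [Complex.sub_re] at h5 h6
      exact ⟨by linarith, by linarith⟩)
    (by simp only [Complex.sub_im] at hf; linarith)
    (by simp only [Complex.sub_im] at hg; linarith)
  rw [range_toCurve_inter_eq_empty_of_dual hiso hrh hclash hω h₂ hpN hqN] at hne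
  exact Set.not_nonempty_empty hne

end Tiling

/-! ### The probability inequality -/

section Probability

variable {V F : Type*} [Countable V] {G : SimpleGraph V} {emb : RhombicEmbedding G F}

/-- **`P_G(horizontal crossing) + P_G(ω* crosses an inner strip vertically) ≤ 1`** (under
`hclash`): the two events meet only inside the null set `{ω ⊄ E(G)}`.
[cite: GrimmettManolescu2014Isoradial, §2.2 and end of §3 (duality for box crossings)] -/
theorem real_embRectCrossing_add_real_dualConfig_preimage_le_one (hiso : emb.IsIsoradial)
    (hrh : emb.IsRhombicTiling) (hclash : ∀ d D : G.Dart, emb.z d.fst ≠ emb.c (emb.leftFace D))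
    {w w' : ℂ} {a b a' b' : ℝ} (ha' : 0 < a') (hb : 0 < b) (h1 : w.re ≤ w'.re)
    (h2 : w'.re + a' ≤ w.re + a) (h3 : w'.im ≤ w.im) (h4 : w.im + b ≤ w'.im + b') :
    emb.isoradialPercolation.real (embRectCrossing (fun v => emb.z v - w) a b) +
      emb.isoradialPercolation.real
        (emb.dualConfig ⁻¹' embTBCrossing (fun f => emb.c f - w') a' b') ≤ 1 := by
  set S := embRectCrossing (fun v => emb.z v - w) a b with hS
  set T := emb.dualConfig ⁻¹' embTBCrossing (fun f => emb.c f - w') a' b' with hT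
  have hSm : MeasurableSet S := by
    rw [hS]; unfold embRectCrossing; exact measurableSet_openCrossing_of_countable _ _ _
  have hST : S ∩ T ⊆ {ω | ¬ ω ⊆ G.edgeSet} := by
    rintro ω ⟨hωS, hωT⟩ hωE
    exact not_mem_embTBCrossing_dualConfig hiso hrh hclash hωE ha' hb h1 h2 h3 h4 hωS hωT
  have h0 : emb.isoradialPercolation.real (S ∩ T) = 0 := by
    apply le_antisymm _ measureReal_nonneg
    calc emb.isoradialPercolation.real (S ∩ T)
        ≤ emb.isoradialPercolation.real {ω | ¬ ω ⊆ G.edgeSet} := measureReal_mono hST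
      _ = 0 := by
        rw [measureReal_def, IsoradialCriticality.isoradialPercolation_not_subset_edgeSet emb,
          ENNReal.toReal_zero]
  have hadd := measureReal_union_add_inter' (μ := emb.isoradialPercolation) hSm (t := T)
  have hle1 : emb.isoradialPercolation.real (S ∪ T) ≤ 1 := measureReal_le_one
  linarith

/-- The same inequality with the dual probability read under the canonical measure of the dual
embedding, `P_G(horizontal crossing) ≤ 1 - P_{G*}(vertical crossing of the inner strip)`
(countable face type, for the measurability of the dual event).
[cite: GrimmettManolescu2014Isoradial, §2.2 (P_{G*} is dual to P_G) and end of §3] -/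
theorem real_embRectCrossing_le_one_sub_dual [Countable F] (hiso : emb.IsIsoradial)
    (hrh : emb.IsRhombicTiling) (hclash : ∀ d D : G.Dart, emb.z d.fst ≠ emb.c (emb.leftFace D))
    {w w' : ℂ} {a b a' b' : ℝ} (ha' : 0 < a') (hb : 0 < b) (h1 : w.re ≤ w'.re)
    (h2 : w'.re + a' ≤ w.re + a) (h3 : w'.im ≤ w.im) (h4 : w.im + b ≤ w'.im + b') :
    emb.isoradialPercolation.real (embRectCrossing (fun v => emb.z v - w) a b) ≤
      1 - emb.dual.isoradialPercolation.real (embTBCrossing (fun f => emb.c f - w') a' b') := by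
  have hm : MeasurableSet (embTBCrossing (fun f => emb.c f - w') a' b') := by
    unfold embTBCrossing; exact measurableSet_openCrossing_of_countable _ _ _
  rw [← isoradialPercolation_real_dualConfig_preimage hiso hrh hm]
  linarith [real_embRectCrossing_add_real_dualConfig_preimage_le_one hiso hrh hclash ha' hb h1 h2
    h3 h4 (emb := emb)]

end Probability

end Literature.Probability.Percolation

end
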